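import Mathlib
import Summits.ABC.ABC.Theses.IneffectiveSubspace

/-!
# Stub `stub_hallLangGivesUL` of line `SketchIdeator5` (idea `cm-hall-lang-transfer`) — crux `IneffectiveSubspace.TowerFourSubLiouville` (stmt-ABC-1649)

HALL–LANG for the CM family `y² = x³ + N·x` ⟹ UNIFORM LJUNGGREN.

Hypothesis (Hall–Lang, `j = 1728`): there are `κ, C` with `C > 0` such that every integral point
`(x, y)` of `y² = x³ + N·x`, `N ≠ 0`, has `|x| ≤ C·|N|^κ`.
Conclusion (uniform Ljunggren): there are `K, C` with `C > 0` such that every integer solution of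
`x² − d·y⁴ = k` with `d` not a square and `k ≠ 0` has `|y| ≤ C·(|d|·|k|)^K`.

Proof. Take `K = κ` and the same `C`. If `y = 0` the bound reads `0 ≤ C·(…)^κ`. Otherwise
`d ≠ 0` (`0` is a square), so `N := d·k ≠ 0`, and the dictionary `(X, W) = (d·y², d·x·y)` gives the
integral point `W² = X³ + (d·k)·X`; hence `|d|·y² = |X| ≤ C·|d·k|^κ = C·(|d|·|k|)^κ`, and
`|y| ≤ y² ≤ |d|·y²` because `|y| ≥ 1` and `|d| ≥ 1`.
-/

-- `Summit.ABC.ABC` is the mandated summit-side namespace (CONVENTIONS §2); the duplicate is deliberate.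
set_option linter.dupNamespace false

namespace Summit.ABC.ABC.Theorems.TowerFourSubLiouville

/-- DICTIONARY: a solution of the norm equation `x² − d·y⁴ = k` is the integral point
`(X, W) = (d·y², d·x·y)` on `W² = X³ + (d·k)·X`. -/
theorem hallLangGivesUL_integralPoint (d k x y : ℤ) (h : x ^ 2 - d * y ^ 4 = k) :
    (d * x * y) ^ 2 = (d * y ^ 2) ^ 3 + (d * k) * (d * y ^ 2) := by
  linear_combination (d ^ 2 * y ^ 2) * h

/-- For nonzero integers `d`, `y`: `|y| ≤ |d·y²|` (as reals), since `|y| ≥ 1` and `|d| ≥ 1`. -/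
theorem hallLangGivesUL_abs_le {d y : ℤ} (hd : d ≠ 0) (hy : y ≠ 0) :
    |(y : ℝ)| ≤ |(d : ℝ) * (y : ℝ) ^ 2| := by
  have hy1 : (1 : ℝ) ≤ |(y : ℝ)| := by
    rw [← Int.cast_abs]
    exact_mod_cast Int.one_le_abs hy
  have hd1 : (1 : ℝ) ≤ |(d : ℝ)| := by
    rw [← Int.cast_abs]
    exact_mod_cast Int.one_le_abs hd
  rw [abs_mul, abs_pow, sq]
  calc |(y : ℝ)| ≤ |(y : ℝ)| * |(y : ℝ)| := le_mul_of_one_le_right (abs_nonneg _) hy1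
    _ ≤ |(d : ℝ)| * (|(y : ℝ)| * |(y : ℝ)|) :=
        le_mul_of_one_le_left (mul_nonneg (abs_nonneg _) (abs_nonneg _)) hd1

/-- **Hall–Lang ⟹ uniform Ljunggren** (curried form; same exponent `κ` and constant `C`). -/
theorem hallLangGivesUL_core {κ C : ℝ} (hC : 0 < C)
    (hHL : ∀ N x y : ℤ, N ≠ 0 → y ^ 2 = x ^ 3 + N * x → (|x| : ℝ) ≤ C * (|N| : ℝ) ^ κ) :
    ∀ d k x y : ℤ, ¬ IsSquare d → k ≠ 0 → x ^ 2 - d * y ^ 4 = k →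
      (|y| : ℝ) ≤ C * ((|d| * |k| : ℤ) : ℝ) ^ κ := by
  intro d k x y hd hk h
  have hbase : ((|d| * |k| : ℤ) : ℝ) = |((d * k : ℤ) : ℝ)| := by
    push_cast
    exact (abs_mul _ _).symm
  by_cases hy : y = 0
  · subst hy
    rw [Int.cast_zero, abs_zero]
    exact mul_nonneg hC.le (Real.rpow_nonneg (by rw [hbase]; exact abs_nonneg _) _)
  · have hd0 : d ≠ 0 := fun h0 => hd (h0 ▸ IsSquare.zero)
    have hN : d * k ≠ 0 := mul_ne_zero hd0 hk
    have hX := hHL (d * k) (d * y ^ 2) (d * x * y) hN (hallLangGivesUL_integralPoint d k x y h)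
    rw [hbase]
    calc |(y : ℝ)| ≤ |(d : ℝ) * (y : ℝ) ^ 2| := hallLangGivesUL_abs_le hd0 hy
      _ = |((d * y ^ 2 : ℤ) : ℝ)| := by rw [Int.cast_mul, Int.cast_pow]
      _ ≤ C * |((d * k : ℤ) : ℝ)| ^ κ := hX

/-- Stub 2 of line `SketchIdeator5`, registered form: HALL–LANG for `y² = x³ + N·x` (every integral point,
`N ≠ 0`, has `|x| ≤ C·|N|^κ`) implies UNIFORM LJUNGGREN (every integer solution of `x² − d·y⁴ = k`,
`d` non-square, `k ≠ 0`, has `|y| ≤ C·(|d|·|k|)^K`), with `K = κ` and the same `C`. -/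
theorem stub_hallLangGivesUL : (∃ κ C : ℝ, 0 < C ∧ ∀ N x y : ℤ, N ≠ 0 → y ^ 2 = x ^ 3 + N * x → (|x| : ℝ) ≤ C * (|N| : ℝ) ^ κ) → ∃ K C : ℝ, 0 < C ∧ ∀ d k x y : ℤ, ¬ IsSquare d → k ≠ 0 → x ^ 2 - d * y ^ 4 = k → (|y| : ℝ) ≤ C * ((|d| * |k| : ℤ) : ℝ) ^ K :=
  fun ⟨κ, C, hC, hHL⟩ => ⟨κ, C, hC, hallLangGivesUL_core hC hHL⟩

end Summit.ABC.ABC.Theorems.TowerFourSubLiouville
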